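import Literature.Geometry.Lorentzian.MinkowskiSimplexFit

/-!
# Quantitative Alexandrov–Zeeman on a ball (frame-free zeroth-order rigidity, Minkowskian core)

`quantAlexandrovZeeman_ball`: there are universal `C, δ* > 0` such that a map `k : E4 → E4` preserving
the Minkowski interval of every STEEPLY TIMELIKE pair of points of the Euclidean ball `B(x₀, 20ℓ)` up to
relative error `δ ≤ δ*` (`|η(kz − ky) − η(z − y)| ≤ δ|η(z − y)|` whenever `η(z − y) ≤ −¼‖z − y‖²`) is, on
`B(x₀, ℓ)`, `Cδℓ`-close IN THE DOMAIN FRAME (`k y = A(y + e) + c`, `‖e‖ ≤ Cδℓ`) to an affine map whose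
linear part `A` is `Cδ`-approximately Lorentz.  No continuity of `k`, no bound on `A` (it may be an
arbitrarily large boost).  Proof (§5–§6): place the chronological simplex of
`MinkowskiSimplexFit.lean` at `p₀ = x₀ − 18ℓ∂₀`; Gram data of the image family from intervals by exact
polarisation; the fitted map is approximately Lorentz, injective hence surjective; trilateration is a
LINEAR estimate through the pairings `η(·, qₐ)`.  Sources: Alexandrov (1950); Zeeman, J. Math. Phys. 5
(1964) 490–493 (exact case).  What is NOT here: Lorentzian Gram–Schmidt (an exact Lorentz matrix within
`O(δ)` of `A`), not needed by the consumers.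
-/

noncomputable section

open scoped Topology
open Set

namespace Literature.Geometry.Lorentzian.MinkowskiSimplex

/-! ## §5 The simplex placed in the ball: membership and steepness -/

/-- Base point `p₀ = x₀ − 18ℓ∂₀` and vertices `pₐ = p₀ + qₐ`. [folklore] -/
def p0 (x₀ : E4) (ℓ : ℝ) : E4 := x₀ - (18 * ℓ) • bv0

/-- Vertices of the placed simplex. [folklore] -/
def pv (x₀ : E4) (ℓ : ℝ) (a : Fin 4) : E4 := p0 x₀ ℓ + qv ℓ a

/-- `p₀ − x₀ = −18ℓ∂₀`. [folklore] -/
theorem p0_sub (x₀ : E4) (ℓ : ℝ) : p0 x₀ ℓ - x₀ = -((18 * ℓ) • bv0) := by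
  rw [p0]; abel

/-- `pₐ − p₀ = qₐ`. [folklore] -/
theorem pv_sub_p0 (x₀ : E4) (ℓ : ℝ) (a : Fin 4) : pv x₀ ℓ a - p0 x₀ ℓ = qv ℓ a := by
  rw [pv]; abel

/-- `pₐ − p_b = qₐ − q_b`. [folklore] -/
theorem pv_sub_pv (x₀ : E4) (ℓ : ℝ) (a b : Fin 4) : pv x₀ ℓ a - pv x₀ ℓ b = qv ℓ a - qv ℓ b := by
  rw [pv, pv]; abel

/-- `p₀ ∈ B(x₀, 20ℓ)`. [folklore] -/
theorem p0_mem (x₀ : E4) (ℓ : ℝ) (hℓ : 0 < ℓ) : p0 x₀ ℓ ∈ Metric.ball x₀ (20 * ℓ) := by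
  rw [Metric.mem_ball, dist_eq_norm, p0_sub, norm_neg, norm_smul, Real.norm_eq_abs,
    abs_of_pos (by positivity)]
  have : ‖bv0‖ = 1 := by
    have h : ‖bv0‖ ^ 2 = 1 := by rw [norm_sq_eq]; simp
    exact (pow_eq_one_iff_of_nonneg (norm_nonneg bv0) (by norm_num)).1 h
  rw [this]; linarith

/-- `pₐ ∈ B(x₀, 20ℓ)`. [folklore] -/
theorem pv_mem (x₀ : E4) (ℓ : ℝ) (hℓ : 0 < ℓ) (a : Fin 4) : pv x₀ ℓ a ∈ Metric.ball x₀ (20 * ℓ) := by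
  rw [Metric.mem_ball, dist_eq_norm]
  have hv : pv x₀ ℓ a - x₀ = qv ℓ a - (18 * ℓ) • bv0 := by rw [pv, p0]; abel
  rw [hv]
  have key : ‖qv ℓ a - (18 * ℓ) • bv0‖ ^ 2 < (20 * ℓ) ^ 2 := by
    rw [norm_sq_eq]
    fin_cases a <;> simp [qv, q1, q2, q3, q4] <;> nlinarith
  exact abs_lt_of_sq_lt_sq' key (by positivity) |>.2

/-- Mutual steepness of the simplex: `η(qₐ − q_b, ·) ≤ −¼‖qₐ − q_b‖²` for `a ≠ b`, and of the edges
from `p₀`: `η(qₐ, qₐ) ≤ −¼‖qₐ‖²`. [folklore] -/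
theorem steep_qv_sub (ℓ : ℝ) (a b : Fin 4) :
    Minkowski.bilin (qv ℓ a - qv ℓ b) (qv ℓ a - qv ℓ b) ≤ -(1 / 4) * ‖qv ℓ a - qv ℓ b‖ ^ 2 := by
  apply steep_of
  fin_cases a <;> fin_cases b <;> simp [qv, q1, q2, q3, q4] <;> nlinarith [sq_nonneg ℓ]

/-- Steepness of the edges from `p₀`: `η(qₐ, qₐ) ≤ −¼‖qₐ‖²`. [folklore] -/
theorem steep_qv (ℓ : ℝ) (a : Fin 4) :
    Minkowski.bilin (qv ℓ a) (qv ℓ a) ≤ -(1 / 4) * ‖qv ℓ a‖ ^ 2 := by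
  apply steep_of
  fin_cases a <;> simp [qv, q1, q2, q3, q4] <;> nlinarith [sq_nonneg ℓ]

/-- Component control of `y − x₀` for `y ∈ B(x₀, ℓ)`. [folklore] -/
theorem comp_bounds (x₀ y : E4) (ℓ : ℝ) (hy : y ∈ Metric.ball x₀ ℓ) (μ : Fin 4) :
    -ℓ ≤ y μ - x₀ μ ∧ y μ - x₀ μ ≤ ℓ := by
  rw [Metric.mem_ball, dist_eq_norm] at hy
  have h := abs_apply_le_norm (y - x₀) μ
  rw [PiLp.sub_apply, abs_le] at h
  exact ⟨by linarith [h.1], by linarith [h.2]⟩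

/-- Steepness of `y − pₐ` for `y ∈ B(x₀, ℓ)`. [folklore] -/
theorem steep_sub_pv (x₀ : E4) (ℓ : ℝ) (hℓ : 0 < ℓ) (y : E4) (hy : y ∈ Metric.ball x₀ ℓ) (a : Fin 4) :
    Minkowski.bilin (y - pv x₀ ℓ a) (y - pv x₀ ℓ a) ≤ -(1 / 4) * ‖y - pv x₀ ℓ a‖ ^ 2 := by
  apply steep_of
  obtain ⟨h0l, h0u⟩ := comp_bounds x₀ y ℓ hy 0
  obtain ⟨h1l, h1u⟩ := comp_bounds x₀ y ℓ hy 1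
  obtain ⟨h2l, h2u⟩ := comp_bounds x₀ y ℓ hy 2
  obtain ⟨h3l, h3u⟩ := comp_bounds x₀ y ℓ hy 3
  obtain ⟨hq0, hq1, hq2, hq3⟩ := qv_apply ℓ a
  rw [abs_of_pos hℓ, abs_le] at hq1 hq2 hq3
  have ha : ((a : ℕ) : ℝ) ≤ 3 := by exact_mod_cast Nat.lt_succ_iff.1 a.2
  have ha0 : (0 : ℝ) ≤ (a : ℕ) := by positivity
  have e0 : (y - pv x₀ ℓ a) 0 = (y 0 - x₀ 0) + 18 * ℓ - 3 * ((a : ℕ) + 1) * ℓ := by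
    simp only [pv, p0, PiLp.sub_apply, PiLp.add_apply, PiLp.smul_apply, smul_eq_mul, bv0_apply0, hq0]
    ring
  have e1 : (y - pv x₀ ℓ a) 1 = (y 1 - x₀ 1) - qv ℓ a 1 := by
    simp only [pv, p0, PiLp.sub_apply, PiLp.add_apply, PiLp.smul_apply, smul_eq_mul, bv0_apply1]; ring
  have e2 : (y - pv x₀ ℓ a) 2 = (y 2 - x₀ 2) - qv ℓ a 2 := by
    simp only [pv, p0, PiLp.sub_apply, PiLp.add_apply, PiLp.smul_apply, smul_eq_mul, bv0_apply2]; ring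
  have e3 : (y - pv x₀ ℓ a) 3 = (y 3 - x₀ 3) - qv ℓ a 3 := by
    simp only [pv, p0, PiLp.sub_apply, PiLp.add_apply, PiLp.smul_apply, smul_eq_mul, bv0_apply3]; ring
  rw [e0, e1, e2, e3]
  have hv0 : 5 * ℓ ≤ (y 0 - x₀ 0) + 18 * ℓ - 3 * ((a : ℕ) + 1) * ℓ := by nlinarith
  have hc1 : ((y 1 - x₀ 1) - qv ℓ a 1) ^ 2 ≤ (7 / 5 * ℓ) ^ 2 := by
    have : |(y 1 - x₀ 1) - qv ℓ a 1| ≤ 7 / 5 * ℓ := by rw [abs_le]; constructor <;> linarith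
    exact (sq_le_sq.2 (by rwa [abs_of_pos (by positivity : (0:ℝ) < 7/5*ℓ)]))
  have hc2 : ((y 2 - x₀ 2) - qv ℓ a 2) ^ 2 ≤ (7 / 5 * ℓ) ^ 2 := by
    have : |(y 2 - x₀ 2) - qv ℓ a 2| ≤ 7 / 5 * ℓ := by rw [abs_le]; constructor <;> linarith
    exact (sq_le_sq.2 (by rwa [abs_of_pos (by positivity : (0:ℝ) < 7/5*ℓ)]))
  have hc3 : ((y 3 - x₀ 3) - qv ℓ a 3) ^ 2 ≤ (7 / 5 * ℓ) ^ 2 := by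
    have : |(y 3 - x₀ 3) - qv ℓ a 3| ≤ 7 / 5 * ℓ := by rw [abs_le]; constructor <;> linarith
    exact (sq_le_sq.2 (by rwa [abs_of_pos (by positivity : (0:ℝ) < 7/5*ℓ)]))
  nlinarith [mul_pos hℓ hℓ]

/-- Steepness of `y − p₀` for `y ∈ B(x₀, ℓ)`. [folklore] -/
theorem steep_sub_p0 (x₀ : E4) (ℓ : ℝ) (hℓ : 0 < ℓ) (y : E4) (hy : y ∈ Metric.ball x₀ ℓ) :
    Minkowski.bilin (y - p0 x₀ ℓ) (y - p0 x₀ ℓ) ≤ -(1 / 4) * ‖y - p0 x₀ ℓ‖ ^ 2 := by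
  apply steep_of
  obtain ⟨h0l, h0u⟩ := comp_bounds x₀ y ℓ hy 0
  obtain ⟨h1l, h1u⟩ := comp_bounds x₀ y ℓ hy 1
  obtain ⟨h2l, h2u⟩ := comp_bounds x₀ y ℓ hy 2
  obtain ⟨h3l, h3u⟩ := comp_bounds x₀ y ℓ hy 3
  have e0 : (y - p0 x₀ ℓ) 0 = (y 0 - x₀ 0) + 18 * ℓ := by
    simp only [p0, PiLp.sub_apply, PiLp.smul_apply, smul_eq_mul, bv0_apply0]; ring
  have e1 : (y - p0 x₀ ℓ) 1 = (y 1 - x₀ 1) := by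
    simp only [p0, PiLp.sub_apply, PiLp.smul_apply, smul_eq_mul, bv0_apply1]; ring
  have e2 : (y - p0 x₀ ℓ) 2 = (y 2 - x₀ 2) := by
    simp only [p0, PiLp.sub_apply, PiLp.smul_apply, smul_eq_mul, bv0_apply2]; ring
  have e3 : (y - p0 x₀ ℓ) 3 = (y 3 - x₀ 3) := by
    simp only [p0, PiLp.sub_apply, PiLp.smul_apply, smul_eq_mul, bv0_apply3]; ring
  rw [e0, e1, e2, e3]
  have hc1 : (y 1 - x₀ 1) ^ 2 ≤ ℓ ^ 2 := sq_le_sq.2 (by rw [abs_of_pos hℓ, abs_le]; exact ⟨h1l, h1u⟩)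
  have hc2 : (y 2 - x₀ 2) ^ 2 ≤ ℓ ^ 2 := sq_le_sq.2 (by rw [abs_of_pos hℓ, abs_le]; exact ⟨h2l, h2u⟩)
  have hc3 : (y 3 - x₀ 3) ^ 2 ≤ ℓ ^ 2 := sq_le_sq.2 (by rw [abs_of_pos hℓ, abs_le]; exact ⟨h3l, h3u⟩)
  nlinarith [mul_pos hℓ hℓ]

/-! ## §6 The brick -/

/-- Crude sizes: `‖qₐ − q_b‖ ≤ 26ℓ`, `‖y − pₐ‖ ≤ 19ℓ`, `‖y − p₀‖ ≤ 19ℓ` (`y ∈ B(x₀, ℓ)`). [folklore] -/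
theorem norm_sub_pv_le (x₀ : E4) (ℓ : ℝ) (hℓ : 0 < ℓ) (y : E4) (hy : y ∈ Metric.ball x₀ ℓ) (a : Fin 4) :
    ‖y - pv x₀ ℓ a‖ ≤ 21 * ℓ ∧ ‖y - p0 x₀ ℓ‖ ≤ 21 * ℓ := by
  have h1 : ‖y - x₀‖ < ℓ := by rwa [Metric.mem_ball, dist_eq_norm] at hy
  have h2 := pv_mem x₀ ℓ hℓ a
  have h3 := p0_mem x₀ ℓ hℓ
  rw [Metric.mem_ball, dist_eq_norm] at h2 h3
  constructor
  · calc ‖y - pv x₀ ℓ a‖ = ‖(y - x₀) - (pv x₀ ℓ a - x₀)‖ := by congr 1; abel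
      _ ≤ ‖y - x₀‖ + ‖pv x₀ ℓ a - x₀‖ := norm_sub_le _ _
      _ ≤ 21 * ℓ := by linarith
  · calc ‖y - p0 x₀ ℓ‖ = ‖(y - x₀) - (p0 x₀ ℓ - x₀)‖ := by congr 1; abel
      _ ≤ ‖y - x₀‖ + ‖p0 x₀ ℓ - x₀‖ := norm_sub_le _ _
      _ ≤ 21 * ℓ := by linarith

set_option maxHeartbeats 800000 in
/-- **Quantitative Alexandrov–Zeeman on a ball**: a map of the ball `B(x₀, 20ℓ) ⊂ E4`
preserving the Minkowski interval of every steep pair up to relative error `δ ≤ δ*` is, on `B(x₀, ℓ)`,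
`Cδℓ`-close in the domain frame to an affine map with `Cδ`-approximately Lorentz linear part.
Proof: §1–§5 (chronological simplex, fitted map, index raising, exact polarisation, pairing
inversion).  Alexandrov 1950 / Zeeman 1964 (exact case); elementary quantitative version.
[folklore] -/
theorem quantAlexandrovZeeman_ball :
    ∃ C δs : ℝ, 0 < C ∧ 0 < δs ∧
      ∀ (δ ℓ : ℝ) (x₀ : E4) (k : E4 → E4), 0 < δ → δ ≤ δs → 0 < ℓ →
        (∀ y ∈ Metric.ball x₀ (20 * ℓ), ∀ z ∈ Metric.ball x₀ (20 * ℓ),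
          Minkowski.bilin (z - y) (z - y) ≤ -(1 / 4) * ‖z - y‖ ^ 2 →
          |Minkowski.bilin (k z - k y) (k z - k y) - Minkowski.bilin (z - y) (z - y)| ≤
            δ * |Minkowski.bilin (z - y) (z - y)|) →
        ∃ (A : E4 →L[ℝ] E4) (c : E4),
          (∀ v w : E4, |Minkowski.bilin (A v) (A w) - Minkowski.bilin v w| ≤ C * δ * ‖v‖ * ‖w‖) ∧
          ∀ y ∈ Metric.ball x₀ ℓ, ∃ e : E4, ‖e‖ ≤ C * δ * ℓ ∧ k y = A (y + e) + c := by
  -- constants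
  set c₁ : ℝ := 256 * 16000 with hc₁
  refine ⟨4000000 * c₁, 1 / (1000 * c₁), by positivity, by positivity, ?_⟩
  intro δ ℓ x₀ k hδ hδs hℓ H
  have hc₁pos : 0 < c₁ := by positivity
  have hδc : c₁ * δ ≤ 1 / 1000 := by
    rw [le_div_iff₀ (by positivity)] at hδs; nlinarith
  -- the image family
  set f : Fin 4 → E4 := fun a ↦ k (pv x₀ ℓ a) - k (p0 x₀ ℓ) with hf
  -- interval transfer for simplex pairs
  have hI : ∀ v w : E4, v ∈ Metric.ball x₀ (20 * ℓ) → w ∈ Metric.ball x₀ (20 * ℓ) →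
      Minkowski.bilin (v - w) (v - w) ≤ -(1 / 4) * ‖v - w‖ ^ 2 → ‖v - w‖ ≤ 40 * ℓ →
      |Minkowski.bilin (k v - k w) (k v - k w) - Minkowski.bilin (v - w) (v - w)| ≤ δ * (6400 * ℓ ^ 2) := by
    intro v w hv hw hs hn
    refine (H w hw v hv hs).trans (mul_le_mul_of_nonneg_left ?_ hδ.le)
    calc |Minkowski.bilin (v - w) (v - w)| ≤ 4 * ‖v - w‖ ^ 2 := abs_bilin_self_le _
      _ ≤ 4 * (40 * ℓ) ^ 2 := by gcongr
      _ = 6400 * ℓ ^ 2 := by ring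
  -- Gram defect
  have hG : ∀ a b : Fin 4, |Minkowski.bilin (f a) (f b) - Minkowski.bilin (qv ℓ a) (qv ℓ b)| ≤
      16000 * δ * ℓ ^ 2 := by
    intro a b
    have hpa := pv_mem x₀ ℓ hℓ a
    have hpb := pv_mem x₀ ℓ hℓ b
    have hp0 := p0_mem x₀ ℓ hℓ
    have haa := hI _ _ hpa hp0 (by rw [pv_sub_p0]; exact steep_qv ℓ a)
      (by rw [pv_sub_p0]; linarith [norm_qv_le ℓ hℓ a])
    have hbb := hI _ _ hpb hp0 (by rw [pv_sub_p0]; exact steep_qv ℓ b)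
      (by rw [pv_sub_p0]; linarith [norm_qv_le ℓ hℓ b])
    have hab := hI _ _ hpa hpb (by rw [pv_sub_pv]; exact steep_qv_sub ℓ a b)
      (by rw [pv_sub_pv]; linarith [norm_sub_le (qv ℓ a) (qv ℓ b), norm_qv_le ℓ hℓ a, norm_qv_le ℓ hℓ b])
    rw [pv_sub_p0] at haa hbb
    rw [pv_sub_pv] at hab
    have e1 : f a - f b = k (pv x₀ ℓ a) - k (pv x₀ ℓ b) := by simp only [hf]; abel
    rw [bilin_polar (f a) (f b), bilin_polar (qv ℓ a) (qv ℓ b), e1]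
    rw [abs_le] at haa hbb hab ⊢
    constructor <;> nlinarith [haa.1, haa.2, hbb.1, hbb.2, hab.1, hab.2]
  -- approximate Lorentz
  have hAL : ∀ v w, |Minkowski.bilin (mapA ℓ f v) (mapA ℓ f w) - Minkowski.bilin v w| ≤
      c₁ * δ * ‖v‖ * ‖w‖ := by
    intro v w
    have := abs_bilin_mapA_sub_le ℓ hℓ f (16000 * δ * ℓ ^ 2) hG v w
    calc _ ≤ 256 * (16000 * δ * ℓ ^ 2) * ‖v‖ * ‖w‖ / ℓ ^ 2 := this
      _ = c₁ * δ * ‖v‖ * ‖w‖ := by rw [hc₁]; field_simp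
  have hsurj := mapA_surjective ℓ f (c₁ * δ) (by linarith)
    (fun v w ↦ by simpa [mul_assoc] using hAL v w)
  refine ⟨mapAC ℓ f, k (p0 x₀ ℓ) - mapA ℓ f (p0 x₀ ℓ), fun v w ↦ ?_, fun y hy ↦ ?_⟩
  · rw [mapAC_apply, mapAC_apply]
    calc _ ≤ c₁ * δ * ‖v‖ * ‖w‖ := hAL v w
      _ ≤ 4000000 * c₁ * δ * ‖v‖ * ‖w‖ := by
        have : 0 ≤ c₁ * δ * ‖v‖ * ‖w‖ := by positivity
        nlinarith
  · obtain ⟨u, hu⟩ := hsurj (k y - k (p0 x₀ ℓ))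
    -- pairing estimate
    have hy20 : y ∈ Metric.ball x₀ (20 * ℓ) := Metric.ball_subset_ball (by linarith) hy
    obtain ⟨-, hn0⟩ := norm_sub_pv_le x₀ ℓ hℓ y hy 0
    have hw0 := hI y (p0 x₀ ℓ) hy20 (p0_mem x₀ ℓ hℓ) (steep_sub_p0 x₀ ℓ hℓ y hy) (by linarith)
    have hpair : ∀ a : Fin 4, |Minkowski.bilin (u - (y - p0 x₀ ℓ)) (qv ℓ a)| ≤
        16000 * δ * ℓ ^ 2 + 13 * c₁ * δ * ℓ * ‖u‖ := by
      intro a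
      obtain ⟨hna, -⟩ := norm_sub_pv_le x₀ ℓ hℓ y hy a
      have hwa := hI y (pv x₀ ℓ a) hy20 (pv_mem x₀ ℓ hℓ a) (steep_sub_pv x₀ ℓ hℓ y hy a) (by linarith)
      have hqa := hI (pv x₀ ℓ a) (p0 x₀ ℓ) (pv_mem x₀ ℓ hℓ a) (p0_mem x₀ ℓ hℓ)
        (by rw [pv_sub_p0]; exact steep_qv ℓ a) (by rw [pv_sub_p0]; linarith [norm_qv_le ℓ hℓ a])
      rw [pv_sub_p0] at hqa
      -- image side: η(Au, A qₐ) vs η(u, qₐ)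
      have h1 := hAL u (qv ℓ a)
      rw [hu, mapA_qv ℓ hℓ.ne' f a] at h1
      -- exact polarisations
      have P1 := bilin_polar (k y - k (p0 x₀ ℓ)) (f a)
      have P2 := bilin_polar (y - p0 x₀ ℓ) (qv ℓ a)
      have e1 : k y - k (p0 x₀ ℓ) - f a = k y - k (pv x₀ ℓ a) := by simp only [hf]; abel
      have e2 : y - p0 x₀ ℓ - qv ℓ a = y - pv x₀ ℓ a := by rw [pv]; abel
      rw [e1] at P1
      rw [e2] at P2
      have hq13 : ‖qv ℓ a‖ ≤ 13 * ℓ := norm_qv_le ℓ hℓ a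
      have hbd : c₁ * δ * ‖u‖ * ‖qv ℓ a‖ ≤ 13 * c₁ * δ * ℓ * ‖u‖ := by
        have : 0 ≤ c₁ * δ * ‖u‖ := by positivity
        nlinarith
      rw [map_sub, sub_apply]
      rw [abs_le] at hw0 hwa hqa h1 ⊢
      constructor <;> nlinarith [hw0.1, hw0.2, hwa.1, hwa.2, hqa.1, hqa.2, h1.1, h1.2, P1, P2, hbd]
    -- inversion
    have hD := norm_le_of_pairings ℓ hℓ (u - (y - p0 x₀ ℓ)) _ (hpair 0) (hpair 1) (hpair 2) (hpair 3)
    have hu_le : ‖u‖ ≤ ‖u - (y - p0 x₀ ℓ)‖ + 21 * ℓ :=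
      calc ‖u‖ = ‖(u - (y - p0 x₀ ℓ)) + (y - p0 x₀ ℓ)‖ := by congr 1; abel
        _ ≤ ‖u - (y - p0 x₀ ℓ)‖ + ‖y - p0 x₀ ℓ‖ := norm_add_le _ _
        _ ≤ ‖u - (y - p0 x₀ ℓ)‖ + 21 * ℓ := by linarith
    refine ⟨u - (y - p0 x₀ ℓ), ?_, ?_⟩
    · rw [le_div_iff₀ hℓ] at hD
      set D : ℝ := ‖u - (y - p0 x₀ ℓ)‖ with hDdef
      have hDn : 0 ≤ D := norm_nonneg _
      have h2 : 208 * c₁ * δ * ℓ * ‖u‖ ≤ 208 * c₁ * δ * ℓ * (D + 21 * ℓ) :=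
        mul_le_mul_of_nonneg_left hu_le (by positivity)
      have h3 : D * ℓ ≤ 256000 * δ * ℓ ^ 2 + 208 * c₁ * δ * ℓ * D + 4368 * c₁ * δ * ℓ ^ 2 := by
        linarith [hD, h2]
      have h4 : c₁ * δ * (ℓ * D) ≤ 1 / 1000 * (ℓ * D) :=
        mul_le_mul_of_nonneg_right hδc (by positivity)
      have hc₁ge : (1 : ℝ) ≤ c₁ := by rw [hc₁]; norm_num
      have h6 : 1 * (δ * ℓ ^ 2) ≤ c₁ * (δ * ℓ ^ 2) :=
        mul_le_mul_of_nonneg_right hc₁ge (by positivity)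
      have h5 : D * ℓ ≤ (4000000 * c₁ * δ * ℓ) * ℓ := by nlinarith [h3, h4, h6]
      exact le_of_mul_le_mul_right h5 hℓ
    · rw [mapAC_apply]
      have : y + (u - (y - p0 x₀ ℓ)) = u + p0 x₀ ℓ := by abel
      rw [this, mapA_add, hu]; abel

end Literature.Geometry.Lorentzian.MinkowskiSimplex

end
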